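import Summits.QuantumFields.YangMills.Theorems.SmallCircleAnchorAnchorGapGaussianCovSmooth
import Mathlib.MeasureTheory.Measure.Haar.NormedSpace
import HarnessLib

/-!
# Crux `AnchorGap` (stmt-QuantumFields-11141), line `registered` — a UNIFORM Gaussian moment bound:
# `E_M[(1 + Σᵢφᵢ²)^m] ≤ m!·(4Λ)^m·e^{1/(4Λ)}·√2^{|ι|}` whenever `φᵀMφ ≤ Λ‖φ‖₂²` (step towards GBND's
# hypothesis for GREP's own polynomial-growth class)

GBND (`stub_bbfActivityTreeBound`) needs the per-script bound
`|E(cov X σ_s(t))(D^s Π_{b∈X} G_b)| ≤ M·Π y`; ✓`ActBound.abs_gaussExpect_foldl_dop_prod_le` (p795527)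
supplies it for atom factors with BOUNDED derivative tables.  GREP's registered hypothesis on the
`G_b` is the polynomial-growth class `‖DⁿG_b(φ)‖ ≤ K(1 + Σᵢφᵢ²)^m`; for it one needs, in addition, a
bound on the Gaussian moments `E_{cov X σ}[(1 + Σᵢφᵢ²)^m]` UNIFORM over the interpolation points `σ`.
This file proves the generic bound from an upper bound `Λ` on the covariance form alone (no
determinant, no lower eigenvalue bound — these are not uniform over the interpolation):

* §1 `sq_dotProduct_mulVec_le` — Cauchy–Schwarz for the form of a positive definite matrix;
  `inv_coercive_of_form_le` — `φᵀMφ ≤ Λ‖φ‖² ⇒ φᵀM⁻¹φ ≥ ‖φ‖²/Λ`;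
* §2 `integral_gauss_half` — `∫ e^{−¼φᵀPφ} = √2^{|ι|} ∫ e^{−½φᵀPφ}` (Mathlib `Measure.integral_comp_smul`);
* §3 `polyWeight_mul_gauss_le` — pointwise `(1+s)^m e^{−½φᵀPφ} ≤ m!a^{−m}e^{a}·e^{−¼φᵀPφ}` at
  `a = c/4` for a `c`-coercive `P` (`Real.pow_div_factorial_le_exp`, as in
  ✓`integrable_polyGrowth_mul_gaussian`);
* §4 `gaussExpect_polyWeight_le` — the displayed bound for the normalised expectation
  `E_M(H) = ∫ H e^{−½φᵀM⁻¹φ} ∕ ∫ e^{−½φᵀM⁻¹φ}` of GREP.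

[folklore] Gaussian calculus; no definition, no named fact.
-/

set_option autoImplicit false

namespace Summit.QuantumFields.YangMills.Theorems.AnchorGap.GaussMoment

open MeasureTheory Finset Matrix
open scoped Matrix

variable {ι : Type} [Fintype ι] [DecidableEq ι]

/-! ### §1 Cauchy–Schwarz for a positive definite form; coercivity of the inverse -/

omit [Fintype ι] [DecidableEq ι] in
/-- The real matrix of a positive definite (Hermitian) matrix is symmetric: `Mᵀ = M`. [folklore] -/
theorem transpose_eq_of_posDef {M : Matrix ι ι ℝ} (hM : M.PosDef) : Mᵀ = M := by
  have h : M.IsSymm := by simpa using hM.isHermitian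
  exact h.eq

omit [DecidableEq ι] in
/-- Symmetry of the form of a symmetric matrix: `v·(Mu) = u·(Mv)`. [folklore] -/
theorem dotProduct_mulVec_comm_of_transpose_eq {M : Matrix ι ι ℝ} (hMt : Mᵀ = M) (u v : ι → ℝ) :
    v ⬝ᵥ (M *ᵥ u) = u ⬝ᵥ (M *ᵥ v) := by
  rw [Matrix.dotProduct_mulVec, ← Matrix.mulVec_transpose, hMt, dotProduct_comm]

omit [DecidableEq ι] in
/-- **Cauchy–Schwarz for the form of a positive definite real matrix**:
`(u·Mv)² ≤ (u·Mu)(v·Mv)`. [folklore] -/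
theorem sq_dotProduct_mulVec_le {M : Matrix ι ι ℝ} (hM : M.PosDef) (u v : ι → ℝ) :
    (u ⬝ᵥ (M *ᵥ v)) ^ 2 ≤ (u ⬝ᵥ (M *ᵥ u)) * (v ⬝ᵥ (M *ᵥ v)) := by
  have hMt := transpose_eq_of_posDef hM
  have hnn : ∀ φ : ι → ℝ, 0 ≤ φ ⬝ᵥ (M *ᵥ φ) := fun φ => by
    simpa using hM.posSemidef.dotProduct_mulVec_nonneg φ
  set A := u ⬝ᵥ (M *ᵥ u) with hA
  set B := u ⬝ᵥ (M *ᵥ v) with hB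
  set D := v ⬝ᵥ (M *ᵥ v) with hD
  -- the form along the line `u + t v`
  have hline : ∀ t : ℝ, 0 ≤ A + 2 * t * B + t ^ 2 * D := by
    intro t
    have h := hnn (u + t • v)
    have hexp : (u + t • v) ⬝ᵥ (M *ᵥ (u + t • v)) = A + 2 * t * B + t ^ 2 * D := by
      rw [Matrix.mulVec_add, Matrix.mulVec_smul, add_dotProduct, dotProduct_add, dotProduct_add,
        smul_dotProduct, smul_dotProduct, dotProduct_smul, dotProduct_smul,
        dotProduct_mulVec_comm_of_transpose_eq hMt u v]
      simp only [smul_eq_mul, hA, hB, hD]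
      ring
    rw [hexp] at h
    exact h
  by_cases hD0 : D = 0
  · -- then `v = 0` (positive definiteness), so `B = 0`
    have hv : v = 0 := by
      by_contra hv
      have hpos : 0 < v ⬝ᵥ (M *ᵥ v) := by simpa using hM.dotProduct_mulVec_pos hv
      exact absurd hD0 (ne_of_gt (hD ▸ hpos))
    have hB0 : B = 0 := by rw [hB, hv, Matrix.mulVec_zero, dotProduct_zero]
    rw [hB0, hD0]; simp
  · have hDpos : 0 < D := lt_of_le_of_ne (hnn v) (Ne.symm hD0)
    have h := hline (-B / D)
    have hcalc : A + 2 * (-B / D) * B + (-B / D) ^ 2 * D = A - B ^ 2 / D := by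
      field_simp
      ring
    rw [hcalc] at h
    have h2 : B ^ 2 / D ≤ A := by linarith
    rw [div_le_iff₀ hDpos] at h2
    linarith [h2]

/-- **An upper bound on the covariance form is a coercivity bound for the precision**: for `M`
positive definite with `φᵀMφ ≤ Λ Σᵢφᵢ²`, `Λ⁻¹ Σᵢφᵢ² ≤ φᵀM⁻¹φ`. [folklore] -/
theorem inv_coercive_of_form_le {M : Matrix ι ι ℝ} (hM : M.PosDef) {Λ : ℝ} (hΛ : 0 < Λ)
    (hb : ∀ φ : ι → ℝ, φ ⬝ᵥ (M *ᵥ φ) ≤ Λ * ∑ i, φ i ^ 2) (φ : ι → ℝ) :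
    Λ⁻¹ * ∑ i, φ i ^ 2 ≤ φ ⬝ᵥ (M⁻¹ *ᵥ φ) := by
  have hMt := transpose_eq_of_posDef hM
  have hdet : IsUnit M.det := isUnit_iff_ne_zero.2 hM.det_pos.ne'
  set ψ : ι → ℝ := M⁻¹ *ᵥ φ with hψ
  have hMψ : M *ᵥ ψ = φ := by
    rw [hψ, Matrix.mulVec_mulVec, Matrix.mul_nonsing_inv _ hdet, Matrix.one_mulVec]
  -- `s = Σφᵢ² = ψ·(Mφ)`, `q = φ·(M⁻¹φ) = ψ·(Mψ)`
  have hs : ∑ i, φ i ^ 2 = ψ ⬝ᵥ (M *ᵥ φ) := by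
    rw [dotProduct_mulVec_comm_of_transpose_eq hMt φ ψ, hMψ, dotProduct]
    exact Finset.sum_congr rfl fun i _ => by ring
  have hq : φ ⬝ᵥ (M⁻¹ *ᵥ φ) = ψ ⬝ᵥ (M *ᵥ ψ) := by
    rw [hMψ, ← hψ, dotProduct_comm]
  have hq0 : 0 ≤ φ ⬝ᵥ (M⁻¹ *ᵥ φ) := by
    simpa using hM.inv.posSemidef.dotProduct_mulVec_nonneg φ
  have hcs := sq_dotProduct_mulVec_le hM ψ φ
  -- `s² ≤ q · (φ·Mφ) ≤ q · Λ s`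
  rw [← hs, ← hq] at hcs
  have hs0 : 0 ≤ ∑ i, φ i ^ 2 := Finset.sum_nonneg fun i _ => sq_nonneg _
  have h2 : (∑ i, φ i ^ 2) ^ 2 ≤ (φ ⬝ᵥ (M⁻¹ *ᵥ φ)) * (Λ * ∑ i, φ i ^ 2) :=
    hcs.trans (mul_le_mul_of_nonneg_left (hb φ) hq0)
  by_cases hs00 : ∑ i, φ i ^ 2 = 0
  · rw [hs00, mul_zero]; exact hq0
  · have hspos : 0 < ∑ i, φ i ^ 2 := lt_of_le_of_ne hs0 (Ne.symm hs00)
    have h3 : ∑ i, φ i ^ 2 ≤ (φ ⬝ᵥ (M⁻¹ *ᵥ φ)) * Λ := by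
      have : (∑ i, φ i ^ 2) * (∑ i, φ i ^ 2) ≤ ((φ ⬝ᵥ (M⁻¹ *ᵥ φ)) * Λ) * ∑ i, φ i ^ 2 := by
        rw [← pow_two, mul_assoc]; exact h2
      exact le_of_mul_le_mul_right this hspos
    rw [inv_mul_le_iff₀ hΛ]
    linarith

/-! ### §2 The Gaussian integral at half precision -/

omit [DecidableEq ι] in
/-- **`∫ e^{−¼φᵀPφ} dφ = √2^{|ι|} · ∫ e^{−½φᵀPφ} dφ`** (linear change of variables `φ ↦ φ/√2`,
Mathlib `Measure.integral_comp_smul`). [folklore] -/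
theorem integral_gauss_half (P : Matrix ι ι ℝ) :
    ∫ φ : ι → ℝ, Real.exp (-(φ ⬝ᵥ (P *ᵥ φ)) / 4)
      = Real.sqrt 2 ^ Fintype.card ι * ∫ φ : ι → ℝ, Real.exp (-(φ ⬝ᵥ (P *ᵥ φ)) / 2) := by
  have hR : (Real.sqrt 2)⁻¹ ≠ 0 := inv_ne_zero (Real.sqrt_ne_zero'.2 (by norm_num))
  have h2 : Real.sqrt 2 ^ 2 = 2 := Real.sq_sqrt (by norm_num)
  have hfun : (fun φ : ι → ℝ => Real.exp (-(φ ⬝ᵥ (P *ᵥ φ)) / 4))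
      = fun φ : ι → ℝ => (fun ψ : ι → ℝ => Real.exp (-(ψ ⬝ᵥ (P *ᵥ ψ)) / 2))
          ((Real.sqrt 2)⁻¹ • φ) := by
    funext φ
    simp only [Matrix.mulVec_smul, smul_dotProduct, dotProduct_smul, smul_eq_mul]
    congr 1
    have : (Real.sqrt 2)⁻¹ * ((Real.sqrt 2)⁻¹ * (φ ⬝ᵥ (P *ᵥ φ))) = (φ ⬝ᵥ (P *ᵥ φ)) / 2 := by
      rw [← mul_assoc, ← mul_inv, ← pow_two, h2]; ring
    rw [this]; ring
  have hcs := Measure.integral_comp_smul (μ := (volume : Measure (ι → ℝ)))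
    (fun ψ : ι → ℝ => Real.exp (-(ψ ⬝ᵥ (P *ᵥ ψ)) / 2)) (Real.sqrt 2)⁻¹
  rw [hfun, hcs, Module.finrank_fintype_fun_eq_card, smul_eq_mul]
  congr 1
  rw [inv_pow, inv_inv, abs_of_nonneg (pow_nonneg (Real.sqrt_nonneg _) _)]

/-! ### §3 The pointwise comparison -/

omit [DecidableEq ι] in
/-- **Pointwise:** for a `c`-coercive `P` (`cΣφᵢ² ≤ φᵀPφ`, `c > 0`) and `a = c/4`,
`(1 + Σφᵢ²)^m e^{−½φᵀPφ} ≤ m!·a^{−m}·e^{a} · e^{−¼φᵀPφ}`. [folklore] -/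
theorem polyWeight_mul_gauss_le {P : Matrix ι ι ℝ} {c : ℝ} (hc : 0 < c)
    (hcoer : ∀ φ : ι → ℝ, c * ∑ i, φ i ^ 2 ≤ φ ⬝ᵥ (P *ᵥ φ)) (m : ℕ) (φ : ι → ℝ) :
    (1 + ∑ i, φ i ^ 2) ^ m * Real.exp (-(φ ⬝ᵥ (P *ᵥ φ)) / 2)
      ≤ ((m.factorial : ℝ) * (c / 4)⁻¹ ^ m * Real.exp (c / 4))
        * Real.exp (-(φ ⬝ᵥ (P *ᵥ φ)) / 4) := by
  set a : ℝ := c / 4 with ha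
  have ha0 : 0 < a := by positivity
  set s : ℝ := ∑ i, φ i ^ 2 with hs
  have hs0 : 0 ≤ s := Finset.sum_nonneg fun i _ => sq_nonneg _
  -- `(1+s)^m ≤ m! a^{-m} e^{a(1+s)}`
  have hpoly : (1 + s) ^ m ≤ (m.factorial : ℝ) * a⁻¹ ^ m * Real.exp (a * (1 + s)) := by
    have h := Real.pow_div_factorial_le_exp (x := a * (1 + s)) (by positivity) m
    rw [div_le_iff₀ (by positivity), mul_pow] at h
    have hapos : 0 < a ^ m := pow_pos ha0 m
    calc (1 + s) ^ m = (a ^ m)⁻¹ * (a ^ m * (1 + s) ^ m) := by field_simp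
      _ ≤ (a ^ m)⁻¹ * (Real.exp (a * (1 + s)) * m.factorial) := by gcongr
      _ = (m.factorial : ℝ) * a⁻¹ ^ m * Real.exp (a * (1 + s)) := by rw [inv_pow]; ring
  -- `e^{a s} e^{−½φᵀPφ} ≤ e^{−¼φᵀPφ}` since `a s ≤ ¼ φᵀPφ`
  have hq : a * s ≤ (φ ⬝ᵥ (P *ᵥ φ)) / 4 := by
    have := hcoer φ
    rw [ha]; linarith
  calc (1 + s) ^ m * Real.exp (-(φ ⬝ᵥ (P *ᵥ φ)) / 2)
      ≤ ((m.factorial : ℝ) * a⁻¹ ^ m * Real.exp (a * (1 + s))) * Real.exp (-(φ ⬝ᵥ (P *ᵥ φ)) / 2) :=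
        mul_le_mul_of_nonneg_right hpoly (Real.exp_pos _).le
    _ = ((m.factorial : ℝ) * a⁻¹ ^ m * Real.exp a)
          * Real.exp (a * s + -(φ ⬝ᵥ (P *ᵥ φ)) / 2) := by
        rw [Real.exp_add, show a * (1 + s) = a + a * s by ring, Real.exp_add]; ring
    _ ≤ ((m.factorial : ℝ) * a⁻¹ ^ m * Real.exp a) * Real.exp (-(φ ⬝ᵥ (P *ᵥ φ)) / 4) := by
        refine mul_le_mul_of_nonneg_left (Real.exp_le_exp.2 (by linarith)) (by positivity)

/-! ### §4 The uniform moment bound -/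

/-- **Uniform Gaussian moment bound.** For `M` positive definite with `φᵀMφ ≤ Λ Σᵢφᵢ²` (`Λ > 0`),
the normalised centred Gaussian expectation with covariance `M` (precision `M⁻¹`, GREP's `E M`)
satisfies `E_M[(1 + Σᵢφᵢ²)^m] ≤ m!·(4Λ)^m·e^{1/(4Λ)}·√2^{|ι|}` — a constant depending on `Λ, m, |ι|`
only. [folklore] -/
theorem gaussExpect_polyWeight_le {M : Matrix ι ι ℝ} (hM : M.PosDef) {Λ : ℝ} (hΛ : 0 < Λ)
    (hb : ∀ φ : ι → ℝ, φ ⬝ᵥ (M *ᵥ φ) ≤ Λ * ∑ i, φ i ^ 2) (m : ℕ) :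
    (∫ φ : ι → ℝ, (1 + ∑ i, φ i ^ 2) ^ m * Real.exp (-(φ ⬝ᵥ (M⁻¹ *ᵥ φ)) / 2))
        / (∫ φ : ι → ℝ, Real.exp (-(φ ⬝ᵥ (M⁻¹ *ᵥ φ)) / 2))
      ≤ (m.factorial : ℝ) * (4 * Λ) ^ m * Real.exp (1 / (4 * Λ)) * Real.sqrt 2 ^ Fintype.card ι := by
  set P : Matrix ι ι ℝ := M⁻¹ with hP
  have hPpd : P.PosDef := hM.inv
  -- coercivity of the precision with `c = Λ⁻¹`
  have hcoer : ∀ φ : ι → ℝ, Λ⁻¹ * ∑ i, φ i ^ 2 ≤ φ ⬝ᵥ (P *ᵥ φ) :=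
    inv_coercive_of_form_le hM hΛ hb
  have hc : (0 : ℝ) < Λ⁻¹ := inv_pos.2 hΛ
  -- the partition function is positive (as `Matrix.of` of the function `M`)
  have hZ : 0 < ∫ φ : ι → ℝ, Real.exp (-(φ ⬝ᵥ (P *ᵥ φ)) / 2) := by
    have hint : Integrable (fun φ : ι → ℝ => (1 : ℝ) * Real.exp (-(φ ⬝ᵥ (P *ᵥ φ)) / 2)) :=
      integrable_polyGrowth_mul_gaussian ι P hPpd 0 1 (fun _ => 1)
        measurable_const.aestronglyMeasurable (fun φ => by simp)
    simp only [one_mul] at hint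
    exact integral_exp_pos hint
  -- integrability of both sides of the pointwise comparison
  have hmeas : AEStronglyMeasurable (fun φ : ι → ℝ => (1 + ∑ i, φ i ^ 2) ^ m) volume :=
    (Continuous.pow (continuous_const.add (continuous_finsetSum _ fun i _ =>
      (continuous_apply i).pow 2)) m).aestronglyMeasurable
  have hintL : Integrable (fun φ : ι → ℝ =>
      (1 + ∑ i, φ i ^ 2) ^ m * Real.exp (-(φ ⬝ᵥ (P *ᵥ φ)) / 2)) :=
    integrable_polyGrowth_mul_gaussian ι P hPpd m 1 _ hmeas (fun φ => by
      rw [one_mul, abs_of_nonneg (pow_nonneg (by positivity) _)])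
  have hintHalf : Integrable (fun φ : ι → ℝ => Real.exp (-(φ ⬝ᵥ (P *ᵥ φ)) / 4)) := by
    have hint1 : Integrable (fun φ : ι → ℝ => (1 : ℝ) * Real.exp (-(φ ⬝ᵥ (P *ᵥ φ)) / 2)) :=
      integrable_polyGrowth_mul_gaussian ι P hPpd 0 1 (fun _ => 1)
        measurable_const.aestronglyMeasurable (fun φ => by simp)
    simp only [one_mul] at hint1
    have h := hint1.comp_smul (inv_ne_zero (Real.sqrt_ne_zero'.2 (by norm_num : (0:ℝ) < 2)))
    have h2 : Real.sqrt 2 ^ 2 = 2 := Real.sq_sqrt (by norm_num)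
    refine h.congr (Filter.Eventually.of_forall fun φ => ?_)
    simp only [Matrix.mulVec_smul, smul_dotProduct, dotProduct_smul, smul_eq_mul]
    congr 1
    have : (Real.sqrt 2)⁻¹ * ((Real.sqrt 2)⁻¹ * (φ ⬝ᵥ (P *ᵥ φ))) = (φ ⬝ᵥ (P *ᵥ φ)) / 2 := by
      rw [← mul_assoc, ← mul_inv, ← pow_two, h2]; ring
    rw [this]; ring
  -- integrate the pointwise comparison
  set K : ℝ := (m.factorial : ℝ) * (Λ⁻¹ / 4)⁻¹ ^ m * Real.exp (Λ⁻¹ / 4) with hK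
  have hnum : ∫ φ : ι → ℝ, (1 + ∑ i, φ i ^ 2) ^ m * Real.exp (-(φ ⬝ᵥ (P *ᵥ φ)) / 2)
      ≤ K * (Real.sqrt 2 ^ Fintype.card ι * ∫ φ : ι → ℝ, Real.exp (-(φ ⬝ᵥ (P *ᵥ φ)) / 2)) := by
    rw [← integral_gauss_half P, ← integral_const_mul]
    exact integral_mono hintL (hintHalf.const_mul K) fun φ => polyWeight_mul_gauss_le hc hcoer m φ
  rw [div_le_iff₀ hZ]
  have hKeq : K = (m.factorial : ℝ) * (4 * Λ) ^ m * Real.exp (1 / (4 * Λ)) := by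
    rw [hK]
    have h1 : (Λ⁻¹ / 4)⁻¹ = 4 * Λ := by rw [inv_div, div_eq_mul_inv, inv_inv]
    have h2 : Λ⁻¹ / 4 = 1 / (4 * Λ) := by rw [div_eq_mul_inv, one_div, mul_inv, mul_comm]
    rw [h1, h2]
  calc ∫ φ : ι → ℝ, (1 + ∑ i, φ i ^ 2) ^ m * Real.exp (-(φ ⬝ᵥ (P *ᵥ φ)) / 2)
      ≤ K * (Real.sqrt 2 ^ Fintype.card ι * ∫ φ : ι → ℝ, Real.exp (-(φ ⬝ᵥ (P *ᵥ φ)) / 2)) := hnum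
    _ = (m.factorial : ℝ) * (4 * Λ) ^ m * Real.exp (1 / (4 * Λ)) * Real.sqrt 2 ^ Fintype.card ι
          * ∫ φ : ι → ℝ, Real.exp (-(φ ⬝ᵥ (P *ᵥ φ)) / 2) := by rw [hKeq]; ring

end Summit.QuantumFields.YangMills.Theorems.AnchorGap.GaussMoment
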